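import Mathlib
import HarnessLib
import Summits.PneNP.PneNP.Theses.CnfIdealGenLength
import Summits.PneNP.PneNP.Theorems.CnfIdealGenLengthRankStability
-- (after W1/W2 land:) import Summits.PneNP.PneNP.Theorems.CnfIdealGenLengthRankDefectRepresentationsTheoryToCnf
-- import Summits.PneNP.PneNP.Theorems.CnfIdealGenLengthRankDefectRepresentationsDiagonal

/-!
# Crux `RankDefectRepresentations` (stmt-PneNP-18923), line `phantom-kernel`: the transfer, closed modulo S1

Lead-prover file (prover-lead-stmt-PneNP-18923-g0, 2026-08-27).  The crux
`Summit.PneNP.PneNP.Theses.CnfIdealGenLength.RankDefectRepresentations` (RDR) asks for a polynomial-size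
unsatisfiable CNF family `φ_n` and, for every exponent `c` and all large `n`, almost-representations `M` of the
Boolean cube in characteristic `0` (every Boolean / commutator axiom of rank `≤ t` at `M`) with
`rank P_φ(M) > n^c · t`.  The line reads the formula OFF a partial model: a pair `(M, U)` VALIDATES a clause `κ`
when its clause word kills `U`; if the validated clauses of length `≤ w` are jointly unsatisfiable
("contradictory width-`w` phantom theory") they ARE an unsatisfiable CNF whose PHANTOM KERNEL
`⋂_κ ker Q_κ(M)` contains `U`, and `dim ⋂_κ ker Q_κ(M) ≤ rank P_φ(M)` for EVERY tuple by peeling the factors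
`1 - Q_κ` right to left (`finrank_iInf_ker_le_rank_clauseProduct`, no commutation used).

Main results (all statements in library vocabulary, no new definitions):
* `finrank_iInf_ker_le_rank_clauseProduct` — the peeling lemma;
* `rankDefectRepresentations_of_contradictoryPhantoms` — S1 ("contradictory phantoms": `∃ w ∀ c ∀ᶠ n ∃ K d t M U`,
  axiom ranks `≤ t`, `dim U > n^c t`, width-`w` phantom theory contradictory) implies RDR, using the landed tool
  stubs `stub_theoryToCnf` (W1) and `stub_diagonal` (W2) of the registered skeleton
  `Cruxes/RankDefectRepresentations/Lines/phantom_kernel.lean`;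
* `not_contradictoryPhantoms_of_polyStable` — the KILL PATH: polynomial rank-stability of the Boolean/commutator
  presentation (hypothesis shape `hST` of the landed `not_rankDefectRepresentations_of_polyStable`, p542939)
  refutes S1.
So the crux is CLOSED MODULO S1 in the tree, and S1 dies with RDR under ST-poly.  HONEST FRAMING: S1 is the crux's
whole difficulty (any proof is a superpolynomial Frege lower bound by the in-tree ceiling `proofRepr` + rank
counting); P ≠ NP is not moved by anything here; F-N2 is a FRONTIER formal rung.
-/

set_option linter.dupNamespace false -- `Summit.PneNP.PneNP.…`: summit = sub-problem name (D-0017)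

namespace Summit.PneNP.PneNP.Theorems.CnfIdealGenLength

open Filter
open Literature.Computability.Complexity
open Literature.Computability.MetaComplexity
open Literature.Computability.MetaComplexity.NCIPS

section Peeling

variable {K : Type} [Field K] {n d : ℕ}

/-- Peeling: if every clause word of `φ` kills `u` at `M`, then `P_φ(M) u = u` (the factors `1 - Q_κ(M)` are
peeled right to left; neither commutation nor the clause order is used). -/
theorem clauseProduct_mulVec_eq_self_of_forall (M : Fin n → Matrix (Fin d) (Fin d) K) (φ : CNF (Fin n))
    (u : Fin d → K)
    (hu : ∀ κ ∈ φ, (MonoidAlgebra.lift K (Matrix (Fin d) (Fin d) K) (FreeMonoid (Fin n)) (FreeMonoid.lift M)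
      (clauseWord K κ)).mulVec u = 0) :
    (MonoidAlgebra.lift K (Matrix (Fin d) (Fin d) K) (FreeMonoid (Fin n)) (FreeMonoid.lift M)
      (clauseProduct K φ)).mulVec u = u := by
  induction φ with
  | nil => simp [clauseProduct_nil]
  | cons κ φ ih =>
    have hκ := hu κ (by simp)
    have ih' := ih (fun κ' hκ' => hu κ' (by simp [hκ']))
    rw [clauseProduct_cons, map_mul, ← Matrix.mulVec_mulVec, ih', map_sub, map_one,
      Matrix.sub_mulVec, Matrix.one_mulVec, hκ, sub_zero]

/-- **Peeling lemma.** The common kernel of the clause words of `φ` at `M` (the phantom kernel) has dimension at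
most `rank P_φ(M)`, for EVERY matrix tuple `M`: `P_φ(M)` restricts to the identity on it. -/
theorem finrank_iInf_ker_le_rank_clauseProduct (M : Fin n → Matrix (Fin d) (Fin d) K) (φ : CNF (Fin n)) :
    Module.finrank K (⨅ κ ∈ φ, LinearMap.ker (Matrix.toLin'
      (MonoidAlgebra.lift K (Matrix (Fin d) (Fin d) K) (FreeMonoid (Fin n)) (FreeMonoid.lift M)
        (clauseWord K κ))) : Submodule K (Fin d → K)) ≤
    (MonoidAlgebra.lift K (Matrix (Fin d) (Fin d) K) (FreeMonoid (Fin n)) (FreeMonoid.lift M)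
      (clauseProduct K φ)).rank := by
  unfold Matrix.rank
  apply Submodule.finrank_mono
  intro u hu
  refine ⟨u, ?_⟩
  rw [Matrix.mulVecLin_apply]
  apply clauseProduct_mulVec_eq_self_of_forall
  intro κ hκ
  simp only [Submodule.mem_iInf, LinearMap.mem_ker, Matrix.toLin'_apply] at hu
  exact hu κ hκ

end Peeling

/-! ### The transfer S1 ⇒ RDR (through the tool stubs S2, S3 of the registered skeleton) -/

/-- From CONTRADICTORY PHANTOMS (S1 of the line `phantom-kernel`, unfolded) to the crux, given the two tool stubs
THEORY-TO-CNF (S2) and DIAGONAL (S3) in their registered forms: read the unsatisfiable CNF off the phantom theory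
(S2, uniform size `(w+1)(2n+2)^(w+1)`), choose one family diagonally (S3), and bound the phantom kernel by the
clause-product rank (peeling). -/
theorem rankDefectRepresentations_of_contradictoryPhantoms_of_tools
    (hS2 : ∀ (n w : ℕ) (K : Type) [Field K] (d : ℕ) (M : Fin n → Matrix (Fin d) (Fin d) K)
      (U : Submodule K (Fin d → K)),
      (∀ σ : Fin n → Bool, ∃ κ : Clause (Fin n), κ.length ≤ w ∧
        (∀ u ∈ U, (MonoidAlgebra.lift K (Matrix (Fin d) (Fin d) K) (FreeMonoid (Fin n))
          (FreeMonoid.lift M) (clauseWord K κ)).mulVec u = 0) ∧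
        Clause.eval σ κ = false) →
      ∃ φ : CNF (Fin n), ¬ φ.Satisfiable ∧ CNF.numClauses φ ≤ (2 * n + 2) ^ (w + 1) ∧
        CNF.size φ ≤ (w + 1) * (2 * n + 2) ^ (w + 1) ∧
        U ≤ ⨅ κ ∈ φ, LinearMap.ker (Matrix.toLin'
          (MonoidAlgebra.lift K (Matrix (Fin d) (Fin d) K) (FreeMonoid (Fin n)) (FreeMonoid.lift M)
            (clauseWord K κ))))
    (hS3 : ∀ p : Polynomial ℕ,
      (∀ c : ℕ, ∀ᶠ n : ℕ in atTop, ∃ φ : CNF (Fin n),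
        (¬ φ.Satisfiable ∧ CNF.numClauses φ ≤ p.eval n ∧ CNF.size φ ≤ p.eval n) ∧
        ∃ (K : Type) (_ : Field K) (_ : CharZero K) (d t : ℕ) (M : Fin n → Matrix (Fin d) (Fin d) K),
          (∀ g : MonoidAlgebra K (FreeMonoid (Fin n)), IsAxiom g →
            (MonoidAlgebra.lift K (Matrix (Fin d) (Fin d) K) (FreeMonoid (Fin n)) (FreeMonoid.lift M)
              g).rank ≤ t) ∧
          n ^ c * t < Module.finrank K (⨅ κ ∈ φ, LinearMap.ker (Matrix.toLin'
            (MonoidAlgebra.lift K (Matrix (Fin d) (Fin d) K) (FreeMonoid (Fin n)) (FreeMonoid.lift M)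
              (clauseWord K κ))) : Submodule K (Fin d → K))) →
      ∃ p' : Polynomial ℕ, ∃ φ : (n : ℕ) → CNF (Fin n),
        (∀ n, ¬ (φ n).Satisfiable ∧ CNF.numClauses (φ n) ≤ p'.eval n ∧ CNF.size (φ n) ≤ p'.eval n) ∧
        ∀ c : ℕ, ∀ᶠ n : ℕ in atTop, ∃ (K : Type) (_ : Field K) (_ : CharZero K) (d t : ℕ)
          (M : Fin n → Matrix (Fin d) (Fin d) K),
          (∀ g : MonoidAlgebra K (FreeMonoid (Fin n)), IsAxiom g →
            (MonoidAlgebra.lift K (Matrix (Fin d) (Fin d) K) (FreeMonoid (Fin n)) (FreeMonoid.lift M)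
              g).rank ≤ t) ∧
          n ^ c * t < Module.finrank K (⨅ κ ∈ φ n, LinearMap.ker (Matrix.toLin'
            (MonoidAlgebra.lift K (Matrix (Fin d) (Fin d) K) (FreeMonoid (Fin n)) (FreeMonoid.lift M)
              (clauseWord K κ))) : Submodule K (Fin d → K)))
    (hS1 : ∃ w : ℕ, ∀ c : ℕ, ∀ᶠ n : ℕ in atTop, ∃ (K : Type) (_ : Field K) (_ : CharZero K) (d t : ℕ)
      (M : Fin n → Matrix (Fin d) (Fin d) K) (U : Submodule K (Fin d → K)),
      (∀ g : MonoidAlgebra K (FreeMonoid (Fin n)), IsAxiom g →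
        (MonoidAlgebra.lift K (Matrix (Fin d) (Fin d) K) (FreeMonoid (Fin n)) (FreeMonoid.lift M) g).rank
          ≤ t) ∧
      n ^ c * t < Module.finrank K U ∧
      ∀ σ : Fin n → Bool, ∃ κ : Clause (Fin n), κ.length ≤ w ∧
        (∀ u ∈ U, (MonoidAlgebra.lift K (Matrix (Fin d) (Fin d) K) (FreeMonoid (Fin n))
          (FreeMonoid.lift M) (clauseWord K κ)).mulVec u = 0) ∧
        Clause.eval σ κ = false) :
    Summit.PneNP.PneNP.Theses.CnfIdealGenLength.RankDefectRepresentations := by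
  obtain ⟨w, hw⟩ := hS1
  -- the uniform size polynomial `(w+1) (2X+2)^(w+1)`
  set p : Polynomial ℕ := Polynomial.C (w + 1) * (Polynomial.C 2 * Polynomial.X + Polynomial.C 2) ^ (w + 1)
    with hp
  have hpeval : ∀ n : ℕ, p.eval n = (w + 1) * (2 * n + 2) ^ (w + 1) := by
    intro n; simp [hp, Polynomial.eval_mul, Polynomial.eval_pow, Polynomial.eval_add]
  have hpw : ∀ c : ℕ, ∀ᶠ n : ℕ in atTop, ∃ φ : CNF (Fin n),
      (¬ φ.Satisfiable ∧ CNF.numClauses φ ≤ p.eval n ∧ CNF.size φ ≤ p.eval n) ∧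
      ∃ (K : Type) (_ : Field K) (_ : CharZero K) (d t : ℕ) (M : Fin n → Matrix (Fin d) (Fin d) K),
        (∀ g : MonoidAlgebra K (FreeMonoid (Fin n)), IsAxiom g →
          (MonoidAlgebra.lift K (Matrix (Fin d) (Fin d) K) (FreeMonoid (Fin n)) (FreeMonoid.lift M)
            g).rank ≤ t) ∧
        n ^ c * t < Module.finrank K (⨅ κ ∈ φ, LinearMap.ker (Matrix.toLin'
          (MonoidAlgebra.lift K (Matrix (Fin d) (Fin d) K) (FreeMonoid (Fin n)) (FreeMonoid.lift M)
            (clauseWord K κ))) : Submodule K (Fin d → K)) := by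
    intro c
    filter_upwards [hw c] with n hn
    obtain ⟨K, iK, iC, d, t, M, U, hM, hlt, hcon⟩ := hn
    obtain ⟨φ, hunsat, hnum, hsize, hU⟩ := hS2 n w K d M U hcon
    refine ⟨φ, ⟨hunsat, ?_, ?_⟩, K, iK, iC, d, t, M, hM, lt_of_lt_of_le hlt (Submodule.finrank_mono hU)⟩
    · rw [hpeval]
      calc CNF.numClauses φ ≤ (2 * n + 2) ^ (w + 1) := hnum
        _ = 1 * (2 * n + 2) ^ (w + 1) := (one_mul _).symm
        _ ≤ (w + 1) * (2 * n + 2) ^ (w + 1) := Nat.mul_le_mul_right _ (Nat.succ_le_succ (Nat.zero_le w))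
    · rw [hpeval]; exact hsize
  obtain ⟨p', φ, hφ, h⟩ := hS3 p hpw
  refine ⟨p', φ, hφ, fun c => ?_⟩
  filter_upwards [h c] with n hn
  obtain ⟨K, iK, iC, d, t, M, hM, hlt⟩ := hn
  exact ⟨K, iK, iC, d, t, M, hM, lt_of_lt_of_le hlt (finrank_iInf_ker_le_rank_clauseProduct M (φ n))⟩

/-! ### The kill path for S1 -/

/-- KILL PATH for the line: polynomial rank-stability of the Boolean/commutator presentation ("ST-poly", the
hypothesis shape of the landed `not_rankDefectRepresentations_of_polyStable`) refutes CONTRADICTORY PHANTOMS (S1),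
given the two (true) tool stubs — because S1 ⇒ RDR and ST-poly ⇒ ¬RDR. -/
theorem not_contradictoryPhantoms_of_polyStable_of_tools
    (hS2 : ∀ (n w : ℕ) (K : Type) [Field K] (d : ℕ) (M : Fin n → Matrix (Fin d) (Fin d) K)
      (U : Submodule K (Fin d → K)),
      (∀ σ : Fin n → Bool, ∃ κ : Clause (Fin n), κ.length ≤ w ∧
        (∀ u ∈ U, (MonoidAlgebra.lift K (Matrix (Fin d) (Fin d) K) (FreeMonoid (Fin n))
          (FreeMonoid.lift M) (clauseWord K κ)).mulVec u = 0) ∧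
        Clause.eval σ κ = false) →
      ∃ φ : CNF (Fin n), ¬ φ.Satisfiable ∧ CNF.numClauses φ ≤ (2 * n + 2) ^ (w + 1) ∧
        CNF.size φ ≤ (w + 1) * (2 * n + 2) ^ (w + 1) ∧
        U ≤ ⨅ κ ∈ φ, LinearMap.ker (Matrix.toLin'
          (MonoidAlgebra.lift K (Matrix (Fin d) (Fin d) K) (FreeMonoid (Fin n)) (FreeMonoid.lift M)
            (clauseWord K κ))))
    (hS3 : ∀ p : Polynomial ℕ,
      (∀ c : ℕ, ∀ᶠ n : ℕ in atTop, ∃ φ : CNF (Fin n),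
        (¬ φ.Satisfiable ∧ CNF.numClauses φ ≤ p.eval n ∧ CNF.size φ ≤ p.eval n) ∧
        ∃ (K : Type) (_ : Field K) (_ : CharZero K) (d t : ℕ) (M : Fin n → Matrix (Fin d) (Fin d) K),
          (∀ g : MonoidAlgebra K (FreeMonoid (Fin n)), IsAxiom g →
            (MonoidAlgebra.lift K (Matrix (Fin d) (Fin d) K) (FreeMonoid (Fin n)) (FreeMonoid.lift M)
              g).rank ≤ t) ∧
          n ^ c * t < Module.finrank K (⨅ κ ∈ φ, LinearMap.ker (Matrix.toLin'
            (MonoidAlgebra.lift K (Matrix (Fin d) (Fin d) K) (FreeMonoid (Fin n)) (FreeMonoid.lift M)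
              (clauseWord K κ))) : Submodule K (Fin d → K))) →
      ∃ p' : Polynomial ℕ, ∃ φ : (n : ℕ) → CNF (Fin n),
        (∀ n, ¬ (φ n).Satisfiable ∧ CNF.numClauses (φ n) ≤ p'.eval n ∧ CNF.size (φ n) ≤ p'.eval n) ∧
        ∀ c : ℕ, ∀ᶠ n : ℕ in atTop, ∃ (K : Type) (_ : Field K) (_ : CharZero K) (d t : ℕ)
          (M : Fin n → Matrix (Fin d) (Fin d) K),
          (∀ g : MonoidAlgebra K (FreeMonoid (Fin n)), IsAxiom g →
            (MonoidAlgebra.lift K (Matrix (Fin d) (Fin d) K) (FreeMonoid (Fin n)) (FreeMonoid.lift M)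
              g).rank ≤ t) ∧
          n ^ c * t < Module.finrank K (⨅ κ ∈ φ n, LinearMap.ker (Matrix.toLin'
            (MonoidAlgebra.lift K (Matrix (Fin d) (Fin d) K) (FreeMonoid (Fin n)) (FreeMonoid.lift M)
              (clauseWord K κ))) : Submodule K (Fin d → K)))
    (hST : ∃ a : ℕ, ∀ᶠ n : ℕ in atTop, ∀ (K : Type) [Field K] [CharZero K] (d t : ℕ)
      (M : Fin n → Matrix (Fin d) (Fin d) K),
      (∀ g : MonoidAlgebra K (FreeMonoid (Fin n)), IsAxiom g →
        (MonoidAlgebra.lift K (Matrix (Fin d) (Fin d) K) (FreeMonoid (Fin n)) (FreeMonoid.lift M) g).rank ≤ t) →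
      ∃ M' : Fin n → Matrix (Fin d) (Fin d) K, (∀ i, M' i * M' i = M' i) ∧ (∀ i j, M' i * M' j = M' j * M' i) ∧
        ∀ i, (M i - M' i).rank ≤ n ^ a * t) :
    ¬ ∃ w : ℕ, ∀ c : ℕ, ∀ᶠ n : ℕ in atTop, ∃ (K : Type) (_ : Field K) (_ : CharZero K) (d t : ℕ)
      (M : Fin n → Matrix (Fin d) (Fin d) K) (U : Submodule K (Fin d → K)),
      (∀ g : MonoidAlgebra K (FreeMonoid (Fin n)), IsAxiom g →
        (MonoidAlgebra.lift K (Matrix (Fin d) (Fin d) K) (FreeMonoid (Fin n)) (FreeMonoid.lift M) g).rank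
          ≤ t) ∧
      n ^ c * t < Module.finrank K U ∧
      ∀ σ : Fin n → Bool, ∃ κ : Clause (Fin n), κ.length ≤ w ∧
        (∀ u ∈ U, (MonoidAlgebra.lift K (Matrix (Fin d) (Fin d) K) (FreeMonoid (Fin n))
          (FreeMonoid.lift M) (clauseWord K κ)).mulVec u = 0) ∧
        Clause.eval σ κ = false := fun hS1 =>
  not_rankDefectRepresentations_of_polyStable hST
    (rankDefectRepresentations_of_contradictoryPhantoms_of_tools hS2 hS3 hS1)

end Summit.PneNP.PneNP.Theorems.CnfIdealGenLength
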